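import Summits.CriticalPhenomena.CardyFormulaZ2.Theorems.CardyAnchoredRigiditySubseqCardyJointLimitCluster
import Summits.CriticalPhenomena.CardyFormulaZ2.Theses.CardyAnchoredRigidity
import Literature.Probability.RandomPlanarGeometry.ConformalRectangleProofs

/-!
# Frame equivalence: `SubseqCardy` ⟺ the Cardy shadow is a cluster point of the crossing-function path
# (crux `SubseqCardy`, stmt-CriticalPhenomena-5768, line `registered`, lead c4)

Route `CardyAnchoredRigidity` (decl shared verbatim with `CardyLocalRigidity`), sub-problem
`CardyFormulaZ2`. This file answers the standing refuter objection that the frame item `SubseqCardy`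
("there are meshes `δ_n → 0⁺` along which `bondDomainCrossingProb R δ_n → F(crossRatio x)` for EVERY
conformal rectangle `R` and EVERY uniformizing datum `(φ, x)` of `R`") is *over-strong* with respect to
what the `Assembly` / `CardyShadowIsolated` (stmt-5767) actually consume. What they consume is: a
**Cardy shadow** `g : ConformalRectangle → ℝ` — a function with
`∀ R φ x, R.IsUniformizing φ x → g R = cardyFunction (crossRatio x)` — that is a `MapClusterPt`, as
`δ → 0⁺`, of the crossing-function path `δ ↦ (R ↦ bondDomainCrossingProb R δ)` in the product space
`ConformalRectangle → ℝ`.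

`subseqCardy_iff_cardyShadow_clusterPt` shows the two are EQUIVALENT, so nothing is over-assumed:

* `→`: uniformizing data exist (`MarkedDomain.exists_isUniformizing_holds`, Riemann + Carathéodory)
  and the cross-ratio does not depend on the datum
  (`ConformalRectangle.crossRatio_eq_of_isUniformizing_holds`), so the Cardy shadow
  `g R := cardyFunction (crossRatio x_R)` (any chosen datum) is well defined and satisfies the shadow
  clause for every datum; it is the joint sequential limit along `SubseqCardy`'s meshes, hence a
  cluster point (`JointLimit.mapClusterPt_of_tendsto`).
* `←`: every cluster point of THIS path is a joint sequential limit along some mesh sequence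
  `u → 0⁺` (`JointLimit.exists_tendsto_of_mapClusterPt`, the "essential separability" of the path,
  part 4 of the structure theory of this line); rewriting `g R = cardyFunction (crossRatio x)` by the
  shadow clause gives `SubseqCardy` verbatim.

Pure bookkeeping over proved tree facts; no named-fact hypotheses.

References: O. Schramm, S. Smirnov, Ann. Probab. 39 (2011) §1.3, §5 (the space of crossing
functions); S. Smirnov, C. R. Acad. Sci. 333 (2001), Thm 1 (Cardy's formula, conformal rectangles).
-/

noncomputable section

namespace Summit.CriticalPhenomena.CardyFormulaZ2.Cruxes.SubseqCardy.Birth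

open Set Filter Topology
open Literature.Probability.RandomPlanarGeometry (ConformalRectangle MarkedDomain ConformalEquiv crossRatio)
open Literature.Probability.Percolation (bondDomainCrossingProb)

/-- **Frame equivalence (crux `SubseqCardy`, stmt-CriticalPhenomena-5768, line `registered`, lead c4).**
`SubseqCardy` — Cardy's formula along ONE sequence of meshes, for every conformal rectangle and every
uniformizing datum at once — holds iff some Cardy shadow `g` (`g R = cardyFunction (crossRatio x)` for
every uniformizing datum `(φ, x)` of `R`) is a cluster point, as `δ → 0⁺`, of the crossing-function
path `δ ↦ (R ↦ bondDomainCrossingProb R δ)` in the product space `ConformalRectangle → ℝ`; the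
right-hand side is exactly the pair of hypotheses consumed by `CardyShadowIsolated` / `Assembly`.
[folklore] -/
theorem subseqCardy_iff_cardyShadow_clusterPt : Summit.CriticalPhenomena.CardyFormulaZ2.Theses.CardyAnchoredRigidity.SubseqCardy ↔ ∃ g : Literature.Probability.RandomPlanarGeometry.ConformalRectangle → ℝ, (∀ (R : Literature.Probability.RandomPlanarGeometry.ConformalRectangle) (φ : Literature.Probability.RandomPlanarGeometry.ConformalEquiv UpperHalfPlane.upperHalfPlaneSet R.carrier) (x : Fin 4 → ℝ), R.IsUniformizing φ x → g R = Literature.Probability.RandomPlanarGeometry.cardyFunction (Literature.Probability.RandomPlanarGeometry.crossRatio x)) ∧ MapClusterPt g (nhdsWithin (0 : ℝ) (Set.Ioi 0)) (fun (δ : ℝ) (R : Literature.Probability.RandomPlanarGeometry.ConformalRectangle) => Literature.Probability.Percolation.bondDomainCrossingProb R δ) := by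
  constructor
  · rintro ⟨u, hu, h⟩
    -- a chosen uniformizing datum `(φ_R, x_R)` of every conformal rectangle
    have hdat : ∀ R : ConformalRectangle,
        R.IsUniformizing (Classical.choose (MarkedDomain.exists_isUniformizing_holds R))
          (Classical.choose (Classical.choose_spec (MarkedDomain.exists_isUniformizing_holds R))) :=
      fun R => Classical.choose_spec (Classical.choose_spec (MarkedDomain.exists_isUniformizing_holds R))
    -- the Cardy shadow, evaluated at the chosen datum
    refine ⟨fun R => Literature.Probability.RandomPlanarGeometry.cardyFunction
      (crossRatio (Classical.choose (Classical.choose_spec (MarkedDomain.exists_isUniformizing_holds R)))),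
      fun R φ x hx => ?_, ?_⟩
    · -- the shadow clause for EVERY datum: the cross-ratio is datum independent
      exact congrArg Literature.Probability.RandomPlanarGeometry.cardyFunction
        (ConformalRectangle.crossRatio_eq_of_isUniformizing_holds (hdat R) hx)
    · -- a joint sequential limit is a cluster point
      exact JointLimit.mapClusterPt_of_tendsto hu fun R => h R _ _ (hdat R)
  · rintro ⟨g, hg, hclu⟩
    -- every cluster point of the crossing-function path is a joint sequential limit
    obtain ⟨u, hu, hgu⟩ := JointLimit.exists_tendsto_of_mapClusterPt hclu
    exact ⟨u, hu, fun R φ x hx => hg R φ x hx ▸ hgu R⟩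

end Summit.CriticalPhenomena.CardyFormulaZ2.Cruxes.SubseqCardy.Birth

end
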